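import Literature.Computability.AlgebraicComplexity.RectangularExponentProofs
import Literature.Computability.AlgebraicComplexity.RectangularExponentHomogeneity
import HarnessLib

/-!
# Lotti–Romani 1983, §1: the rectangular exponent `ω(x, y, z)` is subadditive, positively homogeneous and (jointly) convex

Topic `Literature/Computability/AlgebraicComplexity`. Lotti–Romani 1983, §1 (p. 173), for the exponent
`B(x, y, z)` of `⌈h^x⌉ × ⌈h^y⌉` by `⌈h^y⌉ × ⌈h^z⌉` matrix multiplication:
"from `B(x + x', y + y', z + z') ≤ B(x, y, z) + B(x', y', z')` and `B(νx, νy, νz) = ν B(x, y, z)`, hence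
`B(x, y, z)` is a continuous and convex function". The tree renders `B` as the rank-form rectangular exponent
`omegaRect K x y z = ω_K(x,y,z) = inf {β | R(⟨⌈n^x⌉,⌈n^y⌉,⌈n^z⌉⟩) = O(n^β)}` (`RectangularExponent.lean`, Le Gall
2012 §2) and so far had these statements for ONE slot only: homogeneity by NATURAL factors `omegaRect_smul`
(`RectangularExponentHomogeneity.lean`) and the convexity of `q ↦ ω(1,1,q)` / `k ↦ ω(1,k,1)`
(`RectangularExponentProofs.lean`, `omegaRect_convexOn_one_one`, discharging `omegaRect_convexOn_middle`).
This file types the printed THREE-VARIABLE statements: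

* `LottiRomani1983_subadditive : ω(x+x', y+y', z+z') ≤ ω(x,y,z) + ω(x',y',z')` (all real arguments; at the
  level of admissible exponents `add_mem_rectAdmissibleExponents_add`: `⌈n^{x+x'}⌉ ≤ ⌈n^x⌉⌈n^{x'}⌉` in each
  slot, padding and `R(⟨kk',mm',nn'⟩) ≤ R(⟨k,m,n⟩) R(⟨k',m',n'⟩)`, Bläser 2013 Lemmas 5.4 / 5.8);
* `LottiRomani1983_homogeneous : ω(νx, νy, νz) = ν ω(x,y,z)` for every REAL `ν ≥ 0` and `x, y, z ≥ 0`
  (`smul_mem_rectAdmissibleExponents`: with `m = ⌈n^ν⌉`, `⌈n^{νx}⌉ ≤ ⌈m^x⌉` and `m ≤ 2n^ν`, so `νβ` is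
  admissible for `ν·(x,y,z)` when `β` is for `(x,y,z)`; the reverse inequality is the same with `ν⁻¹`);
* `LottiRomani1983_convexOn : ConvexOn ℝ ([0,∞) × [0,∞) × [0,∞)) ((x,y,z) ↦ ω(x,y,z))` — joint convexity,
  from the two displayed relations exactly as printed; `LottiRomani1983_convexComb_le` is the pointwise form;
* `omegaRect_add_le_add_pos` — the upper half of the printed continuity: `ω(x+δ₁, y+δ₂, z+δ₃) ≤
  ω(x,y,z) + (δ₁⁺ + δ₂⁺ + δ₃⁺)` (subadditivity and `ω(δ₁,δ₂,δ₃) ≤ δ₁⁺+δ₂⁺+δ₃⁺`).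

RENDERING NOTE: Lotti–Romani's `B` is defined through bilinear (rank) complexity of the rectangular formats,
which is the tree's rank form `omegaRect`; the statements are typed for that definition (as the one-slot
convexity already was). The full (two-sided, three-slot Lipschitz) continuity is the cell-side
`Summit.MatrixMultiplication.OmegaCensus.continuous_omegaRect`. Everything here is PROVED; no definitions, no
named facts.

## References

* G. Lotti, F. Romani, *On the asymptotic complexity of rectangular matrix multiplication*, Theoret. Comput.
  Sci. 23 (1983) 171–185, §1 (p. 173). [LottiRomani1983]
* M. Bläser, *Fast Matrix Multiplication*, Theory of Computing Graduate Surveys 5 (2013), Lemmas 5.4, 5.8.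
  [Blaser2013]
-/

noncomputable section

open Filter Asymptotics

namespace Literature.Computability.AlgebraicComplexity

/-! ## Rectangular dimensions: sums and real multiples of exponents -/

/-- `⌈n^{x+x'}⌉ ≤ ⌈n^x⌉ · ⌈n^{x'}⌉` for `n ≥ 1` (any real `x, x'`). [folklore] -/
private theorem rectDim_add_le {n : ℕ} (hn : 1 ≤ n) (x x' : ℝ) :
    rectDim n (x + x') ≤ rectDim n x * rectDim n x' := by
  have h := rectDim_le_rectDim_mul_rectDim hn (x + x') x
  rwa [add_sub_cancel_left] at h

/-- `⌈n^{νw}⌉ ≤ ⌈⌈n^ν⌉^w⌉` for `n ≥ 1` and `w ≥ 0` (any real `ν`): `n^{νw} = (n^ν)^w ≤ ⌈n^ν⌉^w`. [folklore] -/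
private theorem rectDim_mul_le {n : ℕ} (hn : 1 ≤ n) (ν : ℝ) {w : ℝ} (hw : 0 ≤ w) :
    rectDim n (ν * w) ≤ rectDim (rectDim n ν) w := by
  have hn0 : (0 : ℝ) < n := by exact_mod_cast hn
  show ⌈(n : ℝ) ^ (ν * w)⌉₊ ≤ ⌈((rectDim n ν : ℕ) : ℝ) ^ w⌉₊
  refine Nat.ceil_mono ?_
  rw [Real.rpow_mul hn0.le]
  exact Real.rpow_le_rpow (Real.rpow_nonneg hn0.le ν) (Nat.le_ceil _) hw

/-! ## Admissible exponents: a bound valid for every `m ≥ 1` -/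

section LottiRomani

variable (K : Type) [Field K]

/-- An admissible exponent `β` of `(a, b, c)` bounds the rank for **every** `m ≥ 1`, not only eventually:
`R(⟨⌈m^a⌉,⌈m^b⌉,⌈m^c⌉⟩) ≤ C m^β` for some `C > 0` (finitely many exceptions are absorbed into the constant;
the three-slot form of `exists_bound_of_mem_rectAdmissibleExponents_one_one`). [folklore] -/
private theorem exists_bound_of_mem_rectAdmissibleExponents {a b c β : ℝ}
    (hβ : β ∈ rectAdmissibleExponents K a b c) :
    ∃ C : ℝ, 0 < C ∧ ∀ m : ℕ, 1 ≤ m →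
      (tensorRank (matMulTensor K (rectDim m a) (rectDim m b) (rectDim m c)) : ℝ) ≤ C * (m : ℝ) ^ β := by
  obtain ⟨C, hC0, hC⟩ := bound_of_isBigO_nat_atTop hβ
  refine ⟨C, hC0, fun m hm => ?_⟩
  have hm0 : (0 : ℝ) < m := by exact_mod_cast hm
  have h : ‖(tensorRank (matMulTensor K (rectDim m a) (rectDim m b) (rectDim m c)) : ℝ)‖ ≤
      C * ‖(m : ℝ) ^ β‖ := hC (Real.rpow_pos_of_pos hm0 β).ne'
  rwa [Real.norm_of_nonneg (Nat.cast_nonneg _), Real.norm_of_nonneg (Real.rpow_nonneg hm0.le _)] at h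

/-! ## Subadditivity `B(x + x', y + y', z + z') ≤ B(x, y, z) + B(x', y', z')` -/

/-- **Sums of admissible exponents are admissible for the sum of the formats**: if `β` is admissible for
`(x,y,z)` and `β'` for `(x',y',z')`, then `β + β'` is admissible for `(x+x', y+y', z+z')`, since
`R(⟨⌈n^{x+x'}⌉,⌈n^{y+y'}⌉,⌈n^{z+z'}⌉⟩) ≤ R(⟨⌈n^x⌉⌈n^{x'}⌉, ⌈n^y⌉⌈n^{y'}⌉, ⌈n^z⌉⌈n^{z'}⌉⟩)
 ≤ R(⟨⌈n^x⌉,⌈n^y⌉,⌈n^z⌉⟩) · R(⟨⌈n^{x'}⌉,⌈n^{y'}⌉,⌈n^{z'}⌉⟩) ≤ C n^β · C' n^{β'}` (padding, Bläser 2013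
Lemma 5.4; Kronecker product, Lemma 5.8) — the first displayed relation of Lotti–Romani §1 at the level of
admissible exponents. [cite: LottiRomani1983, §1 (p. 173)] -/
theorem add_mem_rectAdmissibleExponents_add {x y z x' y' z' β β' : ℝ}
    (hβ : β ∈ rectAdmissibleExponents K x y z) (hβ' : β' ∈ rectAdmissibleExponents K x' y' z') :
    β + β' ∈ rectAdmissibleExponents K (x + x') (y + y') (z + z') := by
  obtain ⟨C, hC0, hC⟩ := hβ.exists_nonneg
  obtain ⟨C', hC'0, hC'⟩ := hβ'.exists_nonneg
  refine IsBigO.of_bound (C * C') ?_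
  filter_upwards [hC.bound, hC'.bound, eventually_ge_atTop 1] with n hCn hC'n hn
  have hn0 : (0 : ℝ) < n := by exact_mod_cast hn
  rw [Real.norm_of_nonneg (Nat.cast_nonneg _), Real.norm_of_nonneg (Real.rpow_nonneg hn0.le _)]
    at hCn hC'n ⊢
  have hnat : tensorRank (matMulTensor K (rectDim n (x + x')) (rectDim n (y + y')) (rectDim n (z + z'))) ≤
      tensorRank (matMulTensor K (rectDim n x) (rectDim n y) (rectDim n z)) *
        tensorRank (matMulTensor K (rectDim n x') (rectDim n y') (rectDim n z')) :=
    (tensorRank_matMulTensor_mono₃ K (rectDim_add_le hn x x') (rectDim_add_le hn y y')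
      (rectDim_add_le hn z z')).trans
      (Blaser2013_rank_matMulTensor_mul_le K (rectDim n x) (rectDim n y) (rectDim n z) (rectDim n x')
        (rectDim n y') (rectDim n z'))
  have hCβ : 0 ≤ C * (n : ℝ) ^ β := mul_nonneg hC0 (Real.rpow_nonneg hn0.le _)
  calc (tensorRank (matMulTensor K (rectDim n (x + x')) (rectDim n (y + y')) (rectDim n (z + z'))) : ℝ)
      ≤ (tensorRank (matMulTensor K (rectDim n x) (rectDim n y) (rectDim n z)) : ℝ) *
          (tensorRank (matMulTensor K (rectDim n x') (rectDim n y') (rectDim n z')) : ℝ) := by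
        exact_mod_cast hnat
    _ ≤ (C * (n : ℝ) ^ β) * (C' * (n : ℝ) ^ β') := mul_le_mul hCn hC'n (Nat.cast_nonneg _) hCβ
    _ = C * C' * (n : ℝ) ^ (β + β') := by
        rw [Real.rpow_add hn0]; ring

/-- **Lotti–Romani 1983, §1: subadditivity** `B(x + x', y + y', z + z') ≤ B(x, y, z) + B(x', y', z')` of the
rectangular exponent (here for all real arguments). [cite: LottiRomani1983, §1 (p. 173)] -/
theorem LottiRomani1983_subadditive (x y z x' y' z' : ℝ) :
    omegaRect K (x + x') (y + y') (z + z') ≤ omegaRect K x y z + omegaRect K x' y' z' := by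
  refine le_of_forall_pos_le_add fun ε hε => ?_
  have hε2 : 0 < ε / 2 := half_pos hε
  obtain ⟨β, hβ, hβlt⟩ := exists_lt_of_csInf_lt (rectAdmissibleExponents_nonempty K x y z)
    (lt_add_of_pos_right (omegaRect K x y z) hε2)
  obtain ⟨β', hβ', hβ'lt⟩ := exists_lt_of_csInf_lt (rectAdmissibleExponents_nonempty K x' y' z')
    (lt_add_of_pos_right (omegaRect K x' y' z') hε2)
  have hmem := add_mem_rectAdmissibleExponents_add K hβ hβ'
  calc omegaRect K (x + x') (y + y') (z + z') ≤ β + β' :=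
        csInf_le (rectAdmissibleExponents_bddBelow K _ _ _) hmem
    _ ≤ omegaRect K x y z + omegaRect K x' y' z' + ε := by linarith

/-- **Upper half of the continuity in all three slots**: `ω(x+δ₁, y+δ₂, z+δ₃) ≤ ω(x,y,z) + (δ₁⁺ + δ₂⁺ + δ₃⁺)`
(subadditivity and the standard-algorithm bound `ω(δ₁,δ₂,δ₃) ≤ δ₁⁺+δ₂⁺+δ₃⁺`, Bläser 2013 §5; Lotti–Romani
§1: "continuous"). [cite: LottiRomani1983, §1 (p. 173)] -/
theorem omegaRect_add_le_add_pos (x y z δ₁ δ₂ δ₃ : ℝ) :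
    omegaRect K (x + δ₁) (y + δ₂) (z + δ₃) ≤ omegaRect K x y z + (max δ₁ 0 + max δ₂ 0 + max δ₃ 0) := by
  have h₁ := LottiRomani1983_subadditive K x y z δ₁ δ₂ δ₃
  have h₂ := omegaRect_le_max K (rectAdmissibleExponents_bddBelow K δ₁ δ₂ δ₃)
  linarith

/-! ## Positive homogeneity `B(νx, νy, νz) = ν B(x, y, z)` for REAL `ν ≥ 0` -/

/-- **Real multiples of admissible exponents**: if `β` is admissible for `(x,y,z)` (`x, y, z ≥ 0`) and
`ν ≥ 0` is REAL, then `νβ` is admissible for `(νx, νy, νz)`: with `m = ⌈n^ν⌉ ≥ 1`,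
`R(⟨⌈n^{νx}⌉,⌈n^{νy}⌉,⌈n^{νz}⌉⟩) ≤ R(⟨⌈m^x⌉,⌈m^y⌉,⌈m^z⌉⟩) ≤ C m^β ≤ C (2n^ν)^β = C 2^β n^{νβ}`
(the bound for EVERY `m ≥ 1` and `β ≥ 0` by `rectAdmissibleExponents_nonneg`). The natural-`ν` case is the
tree's `mul_mem_rectAdmissibleExponents_smul`. [cite: LottiRomani1983, §1 (p. 173)] -/
theorem smul_mem_rectAdmissibleExponents {ν x y z β : ℝ} (hν : 0 ≤ ν) (hx : 0 ≤ x) (hy : 0 ≤ y)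
    (hz : 0 ≤ z) (hβ : β ∈ rectAdmissibleExponents K x y z) :
    ν * β ∈ rectAdmissibleExponents K (ν * x) (ν * y) (ν * z) := by
  have hβ0 : 0 ≤ β := rectAdmissibleExponents_nonneg K hβ
  obtain ⟨C, hC0, hC⟩ := exists_bound_of_mem_rectAdmissibleExponents K hβ
  refine IsBigO.of_bound (C * 2 ^ β) ?_
  filter_upwards [eventually_ge_atTop 1] with n hn
  have hn0 : (0 : ℝ) < n := by exact_mod_cast hn
  rw [Real.norm_of_nonneg (Nat.cast_nonneg _), Real.norm_of_nonneg (Real.rpow_nonneg hn0.le _)]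
  have hm1 : 1 ≤ rectDim n ν := one_le_rectDim hn ν
  have hR : tensorRank (matMulTensor K (rectDim n (ν * x)) (rectDim n (ν * y)) (rectDim n (ν * z))) ≤
      tensorRank (matMulTensor K (rectDim (rectDim n ν) x) (rectDim (rectDim n ν) y)
        (rectDim (rectDim n ν) z)) :=
    tensorRank_matMulTensor_mono₃ K (rectDim_mul_le hn ν hx) (rectDim_mul_le hn ν hy)
      (rectDim_mul_le hn ν hz)
  have hmle : ((rectDim n ν : ℕ) : ℝ) ≤ 2 * (n : ℝ) ^ ν := by
    simpa [max_eq_left hν] using rectDim_le hn ν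
  calc (tensorRank (matMulTensor K (rectDim n (ν * x)) (rectDim n (ν * y)) (rectDim n (ν * z))) : ℝ)
      ≤ (tensorRank (matMulTensor K (rectDim (rectDim n ν) x) (rectDim (rectDim n ν) y)
          (rectDim (rectDim n ν) z)) : ℝ) := by exact_mod_cast hR
    _ ≤ C * ((rectDim n ν : ℕ) : ℝ) ^ β := hC _ hm1
    _ ≤ C * (2 * (n : ℝ) ^ ν) ^ β :=
        mul_le_mul_of_nonneg_left (Real.rpow_le_rpow (Nat.cast_nonneg _) hmle hβ0) hC0.le
    _ = C * 2 ^ β * (n : ℝ) ^ (ν * β) := by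
        rw [Real.mul_rpow zero_le_two (Real.rpow_nonneg hn0.le _), ← Real.rpow_mul hn0.le]; ring

/-- `ω(νx, νy, νz) ≤ ν ω(x, y, z)` for real `ν ≥ 0` and `x, y, z ≥ 0` (infimum over
`smul_mem_rectAdmissibleExponents`). [cite: LottiRomani1983, §1 (p. 173)] -/
theorem omegaRect_real_smul_le {ν x y z : ℝ} (hν : 0 ≤ ν) (hx : 0 ≤ x) (hy : 0 ≤ y) (hz : 0 ≤ z) :
    omegaRect K (ν * x) (ν * y) (ν * z) ≤ ν * omegaRect K x y z := by
  refine le_of_forall_pos_le_add fun ε hε => ?_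
  have hν1 : 0 < ν + 1 := by linarith
  obtain ⟨β, hβ, hβlt⟩ := exists_lt_of_csInf_lt (rectAdmissibleExponents_nonempty K x y z)
    (lt_add_of_pos_right (omegaRect K x y z) (div_pos hε hν1))
  have hmem := smul_mem_rectAdmissibleExponents K hν hx hy hz hβ
  have h1 : omegaRect K (ν * x) (ν * y) (ν * z) ≤ ν * β :=
    csInf_le (rectAdmissibleExponents_bddBelow K _ _ _) hmem
  have h2 : ν * β ≤ ν * (omegaRect K x y z + ε / (ν + 1)) := mul_le_mul_of_nonneg_left hβlt.le hν
  have h3 : ν * (ε / (ν + 1)) ≤ ε := by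
    rw [mul_div_assoc', div_le_iff₀ hν1]
    nlinarith
  linarith

/-- **Lotti–Romani 1983, §1: positive homogeneity** `B(νx, νy, νz) = ν B(x, y, z)` for every REAL `ν ≥ 0`
and `x, y, z ≥ 0` (the tree's `omegaRect_smul` is the case `ν ∈ ℕ`). For `ν > 0` the inequality `≥` is the
inequality `≤` for `ν⁻¹` applied to `(νx, νy, νz)`; for `ν = 0` both sides vanish (`ω(0,0,0) = 0`).
[cite: LottiRomani1983, §1 (p. 173)] -/
theorem LottiRomani1983_homogeneous {ν x y z : ℝ} (hν : 0 ≤ ν) (hx : 0 ≤ x) (hy : 0 ≤ y) (hz : 0 ≤ z) :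
    omegaRect K (ν * x) (ν * y) (ν * z) = ν * omegaRect K x y z := by
  rcases hν.eq_or_lt with rfl | hνpos
  · simp only [zero_mul]
    refine le_antisymm ?_ (omegaRect_nonneg K 0 0 0)
    simpa using omegaRect_le_max K (rectAdmissibleExponents_bddBelow K 0 0 0)
  · refine le_antisymm (omegaRect_real_smul_le K hν hx hy hz) ?_
    have h := omegaRect_real_smul_le K (inv_nonneg.2 hν) (mul_nonneg hν hx) (mul_nonneg hν hy)
      (mul_nonneg hν hz)
    rw [← mul_assoc, ← mul_assoc, ← mul_assoc, inv_mul_cancel₀ hνpos.ne', one_mul, one_mul, one_mul]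
      at h
    have h' := mul_le_mul_of_nonneg_left h hν
    rwa [← mul_assoc, mul_inv_cancel₀ hνpos.ne', one_mul] at h'

/-! ## Joint convexity -/

/-- **Convex combinations, pointwise**: for `x, y, z, x', y', z' ≥ 0` and weights `a, b ≥ 0` with `a + b = 1`,
`ω(ax + bx', ay + by', az + bz') ≤ a ω(x,y,z) + b ω(x',y',z')` — subadditivity followed by homogeneity,
exactly as printed ("hence `B(x,y,z)` is a … convex function"). [cite: LottiRomani1983, §1 (p. 173)] -/
theorem LottiRomani1983_convexComb_le {x y z x' y' z' a b : ℝ} (hx : 0 ≤ x) (hy : 0 ≤ y) (hz : 0 ≤ z)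
    (hx' : 0 ≤ x') (hy' : 0 ≤ y') (hz' : 0 ≤ z') (ha : 0 ≤ a) (hb : 0 ≤ b) :
    omegaRect K (a * x + b * x') (a * y + b * y') (a * z + b * z') ≤
      a * omegaRect K x y z + b * omegaRect K x' y' z' := by
  calc omegaRect K (a * x + b * x') (a * y + b * y') (a * z + b * z')
      ≤ omegaRect K (a * x) (a * y) (a * z) + omegaRect K (b * x') (b * y') (b * z') :=
        LottiRomani1983_subadditive K _ _ _ _ _ _
    _ = a * omegaRect K x y z + b * omegaRect K x' y' z' := by
        rw [LottiRomani1983_homogeneous K ha hx hy hz, LottiRomani1983_homogeneous K hb hx' hy' hz']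

/-- **Lotti–Romani 1983, §1: `(x, y, z) ↦ B(x, y, z)` is a convex function** on the non-negative orthant
`[0,∞) × [0,∞) × [0,∞)` (joint convexity of the rank-form rectangular exponent; the one-slot statements
`omegaRect_convexOn_one_one` / `omegaRect_convexOn_middle_holds` of the tree are its restrictions to the
lines `(1,1,q)` / `(1,k,1)`). [cite: LottiRomani1983, §1 (p. 173)] -/
theorem LottiRomani1983_convexOn :
    ConvexOn ℝ (Set.Ici (0 : ℝ) ×ˢ (Set.Ici (0 : ℝ) ×ˢ Set.Ici (0 : ℝ)))
      (fun p : ℝ × ℝ × ℝ => omegaRect K p.1 p.2.1 p.2.2) := by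
  refine ⟨(convex_Ici 0).prod ((convex_Ici 0).prod (convex_Ici 0)), ?_⟩
  rintro ⟨x, y, z⟩ hp ⟨x', y', z'⟩ hp' a b ha hb _
  simp only [Set.mem_prod, Set.mem_Ici] at hp hp'
  obtain ⟨hx, hy, hz⟩ := hp
  obtain ⟨hx', hy', hz'⟩ := hp'
  simp only [smul_eq_mul, Prod.smul_mk, Prod.mk_add_mk]
  exact LottiRomani1983_convexComb_le K hx hy hz hx' hy' hz' ha hb

end LottiRomani

end Literature.Computability.AlgebraicComplexity

end
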